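import Summits.ABC.IUTFork.Joshi.PrototypeExponentModel
import Summits.ABC.IUTFork.Joshi.AdelicAnsatzLocalSupplyScaling
import HarnessLib

/-!
# An HONEST instance of the gluing certificate `AdelicCurveDatum.PrototypeSupply`: E-t7's four `ℚ_p`-level inputs of
# [J-III] Thm. 4.2.2.1 HOLD, with GENUINE `j²`-scaling, at the adelic curve datum of the exponent model

Test-side support file of the abc-iut cell, block E «type Joshi's construction, test vs S» (rung LADDER-ABC:A2.E; seat
abc-iut-E-t57, batch-3 «[J-IIp] DERIVABLE/SUPPLIER seat»), sequel of `Joshi/AdelicAnsatzLocalSupply.lean` (p432358: the certificate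
`PrototypeSupply`, the family `PrototypeFamily` and its «local = global» datum), `Joshi/AdelicAnsatzLocalSupplyScaling.lean` (p434715)
and `Joshi/PrototypeExponentModel.lean` (p434861: the Frobenius-BIJECTIVE model of E-t3's [J-IIp] carriers over `Q̄_p`, points = valuation
exponents `ℚ`). It closes the non-vacuity item left open in p432358 §4 («an HONEST instance waits on a model of `PrototypeDatum` with
bijective point-Frobenius and `p`-th roots»): the exponent model supplies both binders, so

* `ExpModel.prototypeFamily p` — a `PrototypeFamily` with ONE residue characteristic, `proto := ExpModel.prototypeDatum p`, `ℓ⋆ = 2`;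
* `ExpModel.adelicCurveDatum p` — E-t7's `AdelicCurveDatum` ([J-III] §4.1–4.2 signature, abc-iut-E-t7 p428940) OF that family (one place,
  bad: `V^{odd,ss} = {w}`), with its certificate `ExpModel.supply p`;
* `ExpModel.inputs` — AT THIS DATUM all four INPUT hypothesis-`Prop`s of `Joshi/AdelicAnsatz.lean` §3 hold (`PrimAnsatzGaloisStable`,
  `PrimAnsatzFrobeniusInvariant` in E-t7's `↔` form, `PrimAnsatzScaling`, and — trivially, `L′*` acting through `ϕ^0` — `LStarThroughFrobenius`),
  hence [J-III] Thm. 4.2.2.1 (1), (2), (3)-diagonal, (4), (5) hold there (E-t7's `_of` theorems);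
* `ExpModel.scaling_genuine` — and the valuation scaling is NOT trivial there: at the Ansatz point of `a = p^{1/4}` the residue valuations
  of `p` at the two labels are `‖p‖^{1/4} ≠ ‖p‖` (contrast: E-t7's `AdelicCurveDatum.trivialModel`, where every valuation is `1`). So the
  conjunction «E-t7's inputs ∧ genuine `j²`-scaling ∧ bijective Frobenius» is SATISFIABLE — a model exhibits satisfiability, nothing more.

SOURCES: K. Joshi, arXiv:2401.13508v4 = [J-III] (unrefereed; bib `Joshi2024ATS3`), Thm. 4.2.2.1 p.32 l.76 – p.33 l.44; arXiv:2303.01662v3 =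
[J-IIp] (bib `Joshi2023ATS2Local`), Def. 6.2.3, Prop. 6.6.1 / 6.7.1, Thm. 6.9.1. TAKES NO SIDE on [IUTchIII] Cor. 3.12, on Joshi's claims or on
Mochizuki's report; typed ≠ proved ≠ endorsed. No FACT-LIST row, no new `Prop`, nothing asserted; R14-clean (Joshi imports only).
-/

noncomputable section

namespace Summit.ABC.IUTFork.Joshi.ExpModel

variable (p : ℕ) [hp : Fact p.Prime]

/-! ## 1. The prototype family and the adelic curve datum of the exponent model -/

/-- **The one-prime prototype family of the exponent model**: residue characteristics `Unit`, `proto := ExpModel.prototypeDatum p`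
(points `ℚ`, `ϕ(r) = p·r`), `ℓ⋆ = 2`; its two binders are the model's `frobY_bijective` and `exists_pth_root`. [folklore] -/
def prototypeFamily : PrototypeFamily Unit (fun _ => PadicAlgCl p) (fun _ => ℚ → PadicAlgCl p) (fun _ => PadicAlgCl p)
    (fun _ => ℚ) (fun _ _ => PadicAlgCl p) (fun _ => Unit) where
  proto _ := prototypeDatum p
  lstar := 2
  one_le_lstar := by norm_num
  lstar_eq _ := rfl
  frobY_bijective _ := frobY_bijective p
  perfect _ := exists_pth_root p

/-- **The adelic curve datum of the exponent model** — E-t7's [J-III] §4.1–4.2 signature at the «local = global» datum of the family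
(one place `w = ()`, declared bad: `V^{odd,ss} := univ`; forgetful map the identity; `L′* := Unit`). [folklore] -/
abbrev adelicCurveDatum : AdelicCurveDatum := (prototypeFamily p).toAdelicCurveDatum Set.univ

/-- Its gluing certificate (p432358 §4, all equations `rfl`). [folklore] -/
def supply : (adelicCurveDatum p).PrototypeSupply (fun _ => PadicAlgCl p) (fun _ => ℚ → PadicAlgCl p) (fun _ => PadicAlgCl p)
    (fun _ _ => PadicAlgCl p) :=
  (prototypeFamily p).supply Set.univ

/-! ## 2. E-t7's four inputs hold at the datum -/

/-- At the «local = global» datum `L′* = Unit` acts trivially, i.e. through `ϕ^0`: E-t7's fourth input `LStarThroughFrobenius`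
([J-2½] Thm. 4.2.3 (4)) holds there for the trivial reason. [folklore] -/
theorem lStarThroughFrobenius : (adelicCurveDatum p).LStarThroughFrobenius :=
  fun _ _ _ => ⟨0, fun _ => by simp; rfl⟩

/-- **ALL FOUR INPUT hypothesis-`Prop`s of `Joshi/AdelicAnsatz.lean` §3 hold at the adelic curve datum of the exponent model** —
the three [J-IIp] inputs by the certificate (p432358: E-t3's `primitiveAnsatz_gal` / `primitiveAnsatz_frob` + perfectness + bijectivity /
`scale_ansatzPt`), the [J-2½] input trivially. [folklore] -/
theorem inputs :
    (adelicCurveDatum p).PrimAnsatzGaloisStable ∧ (adelicCurveDatum p).PrimAnsatzFrobeniusInvariant ∧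
      (adelicCurveDatum p).PrimAnsatzScaling ∧ (adelicCurveDatum p).LStarThroughFrobenius :=
  ⟨(supply p).primAnsatzGaloisStable, (supply p).primAnsatzFrobeniusInvariant, (supply p).primAnsatzScaling,
    lStarThroughFrobenius p⟩

/-- Hence [J-III] Thm. 4.2.2.1 (1), (2), (3) (diagonal reading), (4), (5) ALL hold at the datum (E-t7's `_of` theorems fed by `inputs`).
[claim: Joshi2024ATS3, status: disputed] -/
theorem thm4221 :
    (adelicCurveDatum p).AnsatzGaloisStable ∧ (adelicCurveDatum p).AnsatzFrobeniusStable ∧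
      (adelicCurveDatum p).AnsatzLStarStableDiag ∧ (adelicCurveDatum p).ValuationScaling ∧
        (adelicCurveDatum p).ValuationConstantOffSS :=
  ⟨(supply p).ansatzGaloisStable, (supply p).ansatzFrobeniusStable,
    (supply p).ansatzLStarStableDiag (lStarThroughFrobenius p), (supply p).valuationScaling,
    (adelicCurveDatum p).valuationConstantOffSS_holds⟩

/-! ## 3. The scaling is GENUINE at the datum -/

/-- The Ansatz point of the exponent model at the parameter `a`: at the unique place, the tuple `j ↦ y_j(a)` of E-t3's primitive
Ansatz (= the exponents `(e(a), 4e(a))`, `ExpModel.ansatzPt_eq`). [folklore] -/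
def ansatzTuple (a : PadicAlgCl p) : (adelicCurveDatum p).Tuple := fun j _ => (prototypeDatum p).ansatzPt a j

/-- For `a ∈ 𝔪 ∖ 0` the Ansatz point lies in `Σ̃_{L′}` of the datum (Def. 4.2.2: the bad component is a primitive-Ansatz tuple; there are
no other places). [folklore] -/
theorem ansatzTuple_mem {a : PadicAlgCl p} (ha : a ∈ (prototypeDatum p).AnsatzParam) :
    ansatzTuple p a ∈ (adelicCurveDatum p).adelicAnsatz := by
  refine ⟨fun w hw => absurd (Set.mem_univ w) hw, fun w _ => ?_⟩
  show (fun i : Fin (prototypeDatum p).lstar => (prototypeDatum p).ansatzPt a (Fin.cast rfl i)) ∈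
    (prototypeDatum p).primitiveAnsatz
  exact ⟨a, ha, funext fun i => rfl⟩

/-- The root `a = p^{1/4}` of the model's canonical point is an Ansatz parameter. [folklore] -/
theorem a_mem : (canonicalPoint p).a ∈ (prototypeDatum p).AnsatzParam := (canonicalPoint p).a_mem

/-- **The valuation scaling is GENUINE at the datum**: at the Ansatz point of `a = p^{1/4}`, for `ℓ⋆ = 2`, the residue valuations of
`t = p ∈ Ē` at the labels `j = 1, 2` are NOT all equal (`‖p‖^{1/4}` vs `‖p‖^{1}`) — by `PrototypeFamily.toAdelicCurveDatum_not_valuationDiagonal`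
(p434715) with `t = p ≠ 0`, `|p|_0 ≠ 1`. Contrast: in E-t7's `AdelicCurveDatum.trivialModel` all valuations are `1`. [folklore] -/
theorem scaling_genuine :
    ¬ ∀ i : Fin 2, (adelicCurveDatum p).absK () (ansatzTuple p (canonicalPoint p).a i ()) (p : PadicAlgCl p) =
        (adelicCurveDatum p).absK () (ansatzTuple p (canonicalPoint p).a (adelicCurveDatum p).jOne ()) (p : PadicAlgCl p) := by
  have hp1 : (prototypeDatum p).abs0 (p : PadicAlgCl p) ≠ 1 := ne_of_lt (prototypeDatum p).abs0_p.2
  have hp0 : (p : PadicAlgCl p) ≠ 0 := by exact_mod_cast hp.out.ne_zero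
  exact (prototypeFamily p).toAdelicCurveDatum_not_valuationDiagonal Set.univ (le_refl 2)
    (ansatzTuple_mem p (a_mem p)) (Set.mem_univ ()) hp0 hp1

/-! ## 4. Packaged: the conjunction is satisfiable -/

/-- **SATISFIABILITY (a model exhibits satisfiability, nothing more)**: there is an adelic curve datum (over `Q̄_2`, one bad place,
`ℓ⋆ = 2`) at which E-t7's four inputs hold, [J-III] Thm. 4.2.2.1 (1)–(5) hold, the `ℚ_p`-level Frobenius is a bijection glued to E-t3's
point-Frobenius along a `PrototypeSupply`, AND the `j²`-scaling of Thm. 4.2.2.1 (4) is genuine (some Ansatz point, some `t`, two labels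
with different residue valuations). [folklore] -/
theorem satisfiable :
    ∃ D : AdelicCurveDatum, D.PrimAnsatzGaloisStable ∧ D.PrimAnsatzFrobeniusInvariant ∧ D.PrimAnsatzScaling ∧
      D.LStarThroughFrobenius ∧ D.ValuationScaling ∧
        ∃ (z : D.Tuple) (_ : z ∈ D.adelicAnsatz) (w : D.V) (_ : w ∈ D.oddss) (t : D.T (D.pOf w)),
          ¬ ∀ i : Fin D.lstar, D.absK w (z i w) t = D.absK w (z D.jOne w) t :=
  haveI : Fact (Nat.Prime 2) := ⟨Nat.prime_two⟩
  ⟨adelicCurveDatum 2, (inputs 2).1, (inputs 2).2.1, (inputs 2).2.2.1, (inputs 2).2.2.2, (thm4221 2).2.2.2.1,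
    ansatzTuple 2 (canonicalPoint 2).a, ansatzTuple_mem 2 (a_mem 2), (), Set.mem_univ (), (2 : PadicAlgCl 2),
    by exact_mod_cast scaling_genuine 2⟩

end Summit.ABC.IUTFork.Joshi.ExpModel

end
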